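import Mathlib
import Summits.Ventures.PercRepro2.V2SeriesClosure

/-!
# The Hall form (V2) of (U) is closed under parallel composition; the Harris condition
(seat mine-b, cell pub-perc-repro2; conjectures/MINE-B.md §19)

Continuation of `V2SeriesClosure.lean`.  The *parallel composition* of two labelled posets is the
product preorder with the SUMS of the labels (flows add).  The key is a pointwise identity

  `ν′(x, y) = ν′(x)·[r′ y = 0] + [r x = 0]·ν′(y) + r x·[b x = 0]·([r′ y = 0] − [b′ y = 0])
              + ([r x = 0] − [b x = 0])·r′ y·[b′ y = 0]`

(`nu'_par_eq`).  Summed over an upper set `W`, the first two terms are non-negative by (V2) of the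
factors on the fibres `W^y`, `W_x`, and the last two by the **Harris condition** (HC):
`#(V ∩ {b = 0}) ≤ #(V ∩ {r = 0})` for every upper set `V` — on a pattern cube this is the
Harris–Kleitman inequality applied twice (`{b = 0}` is a lower set, `{r = 0}` an upper set,
`#{r = 0} = #{b = 0}` by the colour swap).  (HC) is itself closed under both compositions
(`harris_ser`, `harris_par`, fibrewise through `{b ≥ 1} × {b′ ≥ 1}` and `{b = 0} × {b′ = 0}`), so
`(V2) ∧ (HC)` is an inductive invariant of series–parallel composition (`V2SP.lean`).
-/

namespace Summit.Ventures.PercRepro2.V2Closure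

open Finset

variable {X Y : Type*}

/-- Red label of the parallel composition: the sum of the two red flows. -/
def parR (r : X → ℕ) (r' : Y → ℕ) (p : X × Y) : ℕ := r p.1 + r' p.2

/-- Blue label of the parallel composition: the sum of the two blue flows. -/
def parB (b : X → ℕ) (b' : Y → ℕ) (p : X × Y) : ℕ := b p.1 + b' p.2

/-- The Harris condition (HC): every upper set contains at least as many `r = 0` configurations as
`b = 0` configurations. -/
def HarrisCond [Preorder X] (r b : X → ℕ) : Prop :=
  ∀ V : Finset X, IsUpperSet (↑V : Set X) →
    ∑ x ∈ V, (if b x = 0 then (1 : ℤ) else 0) ≤ ∑ x ∈ V, (if r x = 0 then (1 : ℤ) else 0)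

/-- Indicator of `{r = 0}`. -/
def indR0 (r : X → ℕ) (x : X) : ℤ := if r x = 0 then 1 else 0

/-- Indicator of `{b = 0}`. -/
def indB0 (b : X → ℕ) (x : X) : ℤ := if b x = 0 then 1 else 0

/-- The weight `r · [b = 0]`. -/
def wR0 (r b : X → ℕ) (x : X) : ℤ := if b x = 0 then (r x : ℤ) else 0

/-- The indicator of `{r = 0}` is non-negative. -/
theorem indR0_nonneg (r : X → ℕ) (x : X) : 0 ≤ indR0 r x := by
  unfold indR0; split_ifs <;> simp

/-- The weight `r · [b = 0]` is non-negative. -/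
theorem wR0_nonneg (r b : X → ℕ) (x : X) : 0 ≤ wR0 r b x := by
  unfold wR0; split_ifs <;> simp

/-- **Pointwise identity for the parallel labels.** -/
theorem nu'_par_eq (r b : X → ℕ) (r' b' : Y → ℕ) (x : X) (y : Y) :
    nu' (parR r r') (parB b b') (x, y)
      = nu' r b x * indR0 r' y + indR0 r x * nu' r' b' y
        + wR0 r b x * (indR0 r' y - indB0 b' y) + (indR0 r x - indB0 b x) * wR0 r' b' y := by
  unfold nu' parR parB indR0 indB0 wR0
  simp only
  rcases (by omega : r x = 0 ∨ r x = 1 ∨ 2 ≤ r x) with h1 | h1 | h1 <;>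
  rcases (by omega : r' y = 0 ∨ r' y = 1 ∨ 2 ≤ r' y) with h2 | h2 | h2 <;>
  rcases (by omega : b x = 0 ∨ 1 ≤ b x) with h3 | h3 <;>
  rcases (by omega : b' y = 0 ∨ 1 ≤ b' y) with h4 | h4 <;>
  simp (disch := omega) only [if_pos, if_neg] <;> push_cast <;> omega

section fibres

/-- (V2) of `X` on the fibre over `y`: `∑_x ind(x,y) · ν′(x) ≥ 0`. -/
theorem fibre_fst_nu'_nonneg [Preorder X] [Preorder Y] [Fintype X] [Fintype Y] [DecidableEq X] [DecidableEq Y] (r b : X → ℕ) (hX : UpDom r b) (W : Finset (X × Y))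
    (hW : IsUpperSet (↑W : Set (X × Y))) (y : Y) :
    0 ≤ ∑ x, ind W x y * nu' r b x := by
  have h := hX (univ.filter (fun x : X => (x, y) ∈ W)) (fibre_fst_isUpperSet W hW y)
  rw [Finset.sum_filter] at h
  have : ∑ x, ind W x y * nu' r b x = ∑ x, (if (x, y) ∈ W then nu' r b x else 0) := by
    apply Finset.sum_congr rfl; intro x _; unfold ind; split_ifs <;> simp
  rw [this]; exact h

/-- (V2) of `Y` on the fibre over `x`. -/
theorem fibre_snd_nu'_nonneg [Preorder X] [Preorder Y] [Fintype X] [Fintype Y] [DecidableEq X] [DecidableEq Y] (r' b' : Y → ℕ) (hY : UpDom r' b') (W : Finset (X × Y))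
    (hW : IsUpperSet (↑W : Set (X × Y))) (x : X) :
    0 ≤ ∑ y, ind W x y * nu' r' b' y := by
  have h := hY (univ.filter (fun y : Y => (x, y) ∈ W)) (fibre_snd_isUpperSet W hW x)
  rw [Finset.sum_filter] at h
  have : ∑ y, ind W x y * nu' r' b' y = ∑ y, (if (x, y) ∈ W then nu' r' b' y else 0) := by
    apply Finset.sum_congr rfl; intro y _; unfold ind; split_ifs <;> simp
  rw [this]; exact h

/-- (HC) of `X` on the fibre over `y`: `∑_x ind(x,y) · ([r x = 0] − [b x = 0]) ≥ 0`. -/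
theorem fibre_fst_harris [Preorder X] [Preorder Y] [Fintype X] [Fintype Y] [DecidableEq X] [DecidableEq Y] (r b : X → ℕ) (hX : HarrisCond r b) (W : Finset (X × Y))
    (hW : IsUpperSet (↑W : Set (X × Y))) (y : Y) :
    0 ≤ ∑ x, ind W x y * (indR0 r x - indB0 b x) := by
  have h := hX (univ.filter (fun x : X => (x, y) ∈ W)) (fibre_fst_isUpperSet W hW y)
  rw [Finset.sum_filter, Finset.sum_filter] at h
  have : ∑ x, ind W x y * (indR0 r x - indB0 b x)
      = ∑ x, (if (x, y) ∈ W then (if r x = 0 then (1 : ℤ) else 0) else 0)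
        - ∑ x, (if (x, y) ∈ W then (if b x = 0 then (1 : ℤ) else 0) else 0) := by
    rw [← Finset.sum_sub_distrib]
    apply Finset.sum_congr rfl; intro x _; unfold ind indR0 indB0; split_ifs <;> simp
  rw [this]; linarith

/-- (HC) of `Y` on the fibre over `x`. -/
theorem fibre_snd_harris [Preorder X] [Preorder Y] [Fintype X] [Fintype Y] [DecidableEq X] [DecidableEq Y] (r' b' : Y → ℕ) (hY : HarrisCond r' b') (W : Finset (X × Y))
    (hW : IsUpperSet (↑W : Set (X × Y))) (x : X) :
    0 ≤ ∑ y, ind W x y * (indR0 r' y - indB0 b' y) := by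
  have h := hY (univ.filter (fun y : Y => (x, y) ∈ W)) (fibre_snd_isUpperSet W hW x)
  rw [Finset.sum_filter, Finset.sum_filter] at h
  have : ∑ y, ind W x y * (indR0 r' y - indB0 b' y)
      = ∑ y, (if (x, y) ∈ W then (if r' y = 0 then (1 : ℤ) else 0) else 0)
        - ∑ y, (if (x, y) ∈ W then (if b' y = 0 then (1 : ℤ) else 0) else 0) := by
    rw [← Finset.sum_sub_distrib]
    apply Finset.sum_congr rfl; intro y _; unfold ind indR0 indB0; split_ifs <;> simp
  rw [this]; linarith

/-- A sum over `W` of `f(x)·g(y)`, fibred over `y` first. -/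
theorem sum_W_eq_snd [Fintype X] [Fintype Y] [DecidableEq X] [DecidableEq Y] (W : Finset (X × Y)) (f : X → ℤ) (g : Y → ℤ) :
    ∑ p ∈ W, f p.1 * g p.2 = ∑ y, g y * ∑ x, ind W x y * f x := by
  rw [sum_W_eq, Finset.sum_comm]
  apply Finset.sum_congr rfl; intro y _
  rw [Finset.mul_sum]; apply Finset.sum_congr rfl; intro x _; ring

/-- A sum over `W` of `f(x)·g(y)`, fibred over `x` first. -/
theorem sum_W_eq_fst [Fintype X] [Fintype Y] [DecidableEq X] [DecidableEq Y] (W : Finset (X × Y)) (f : X → ℤ) (g : Y → ℤ) :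
    ∑ p ∈ W, f p.1 * g p.2 = ∑ x, f x * ∑ y, ind W x y * g y := by
  rw [sum_W_eq]
  apply Finset.sum_congr rfl; intro x _
  rw [Finset.mul_sum]; apply Finset.sum_congr rfl; intro y _; ring

/-- **Theorem B (parallel closure of (V2)).**  If both factors satisfy (V2) and (HC), the parallel
composition satisfies (V2). -/
theorem upDom_par [Preorder X] [Preorder Y] [Fintype X] [Fintype Y] [DecidableEq X] [DecidableEq Y] (r b : X → ℕ) (r' b' : Y → ℕ) (hX : UpDom r b) (hY : UpDom r' b')
    (hXH : HarrisCond r b) (hYH : HarrisCond r' b') : UpDom (parR r r') (parB b b') := by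
  intro W hW
  have hpt : ∑ p ∈ W, nu' (parR r r') (parB b b') p
      = ∑ p ∈ W, nu' r b p.1 * indR0 r' p.2 + ∑ p ∈ W, indR0 r p.1 * nu' r' b' p.2
        + ∑ p ∈ W, wR0 r b p.1 * (indR0 r' p.2 - indB0 b' p.2)
        + ∑ p ∈ W, (indR0 r p.1 - indB0 b p.1) * wR0 r' b' p.2 := by
    simp only [← Finset.sum_add_distrib]
    apply Finset.sum_congr rfl; intro p _
    exact nu'_par_eq r b r' b' p.1 p.2
  rw [hpt]
  have h1 : 0 ≤ ∑ p ∈ W, nu' r b p.1 * indR0 r' p.2 := by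
    rw [sum_W_eq_snd]
    exact Finset.sum_nonneg (fun y _ => mul_nonneg (indR0_nonneg _ _) (fibre_fst_nu'_nonneg r b hX W hW y))
  have h2 : 0 ≤ ∑ p ∈ W, indR0 r p.1 * nu' r' b' p.2 := by
    rw [sum_W_eq_fst]
    exact Finset.sum_nonneg (fun x _ => mul_nonneg (indR0_nonneg _ _) (fibre_snd_nu'_nonneg r' b' hY W hW x))
  have h3 : 0 ≤ ∑ p ∈ W, wR0 r b p.1 * (indR0 r' p.2 - indB0 b' p.2) := by
    have e := sum_W_eq_fst W (wR0 r b) (fun y => indR0 r' y - indB0 b' y)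
    rw [e]
    exact Finset.sum_nonneg (fun x _ => mul_nonneg (wR0_nonneg _ _ _) (fibre_snd_harris r' b' hYH W hW x))
  have h4 : 0 ≤ ∑ p ∈ W, (indR0 r p.1 - indB0 b p.1) * wR0 r' b' p.2 := by
    have e := sum_W_eq_snd W (fun x => indR0 r x - indB0 b x) (wR0 r' b')
    rw [e]
    exact Finset.sum_nonneg (fun y _ => mul_nonneg (wR0_nonneg _ _ _) (fibre_fst_harris r b hXH W hW y))
  linarith

/-- The complement form of (HC) on a fibre: `∑_x ind(x,y)·[b x ≥ 1] ≥ ∑_x ind(x,y)·[r x ≥ 1]`. -/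
theorem fibre_fst_harris' [Preorder X] [Preorder Y] [Fintype X] [Fintype Y] [DecidableEq X] [DecidableEq Y] (r b : X → ℕ) (hX : HarrisCond r b) (W : Finset (X × Y))
    (hW : IsUpperSet (↑W : Set (X × Y))) (y : Y) :
    ∑ x, ind W x y * (if 1 ≤ r x then (1 : ℤ) else 0)
      ≤ ∑ x, ind W x y * (if 1 ≤ b x then (1 : ℤ) else 0) := by
  have h := fibre_fst_harris r b hX W hW y
  have e : ∑ x, ind W x y * (if 1 ≤ b x then (1 : ℤ) else 0)
      - ∑ x, ind W x y * (if 1 ≤ r x then (1 : ℤ) else 0) = ∑ x, ind W x y * (indR0 r x - indB0 b x) := by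
    rw [← Finset.sum_sub_distrib]
    apply Finset.sum_congr rfl; intro x _; unfold indR0 indB0; split_ifs <;> omega
  linarith

/-- The complement form of (HC) on a fibre over `x`. -/
theorem fibre_snd_harris' [Preorder X] [Preorder Y] [Fintype X] [Fintype Y] [DecidableEq X] [DecidableEq Y] (r' b' : Y → ℕ) (hY : HarrisCond r' b') (W : Finset (X × Y))
    (hW : IsUpperSet (↑W : Set (X × Y))) (x : X) :
    ∑ y, ind W x y * (if 1 ≤ r' y then (1 : ℤ) else 0)
      ≤ ∑ y, ind W x y * (if 1 ≤ b' y then (1 : ℤ) else 0) := by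
  have h := fibre_snd_harris r' b' hY W hW x
  have e : ∑ y, ind W x y * (if 1 ≤ b' y then (1 : ℤ) else 0)
      - ∑ y, ind W x y * (if 1 ≤ r' y then (1 : ℤ) else 0) = ∑ y, ind W x y * (indR0 r' y - indB0 b' y) := by
    rw [← Finset.sum_sub_distrib]
    apply Finset.sum_congr rfl; intro y _; unfold indR0 indB0; split_ifs <;> omega
  linarith

/-- **(HC) is closed under series composition**: through the complement form,
`#(W ∩ {b ≥ 1}×{b′ ≥ 1}) ≥ #(W ∩ {r ≥ 1}×{b′ ≥ 1}) ≥ #(W ∩ {r ≥ 1}×{r′ ≥ 1})`. -/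
theorem harris_ser [Preorder X] [Preorder Y] [Fintype X] [Fintype Y] [DecidableEq X] [DecidableEq Y] (r b : X → ℕ) (r' b' : Y → ℕ) (hX : HarrisCond r b) (hY : HarrisCond r' b') :
    HarrisCond (serR r r') (serB b b') := by
  intro W hW
  -- rewrite both sides through the complements
  have key : ∑ p ∈ W, (if 1 ≤ r p.1 then (1 : ℤ) else 0) * (if 1 ≤ r' p.2 then (1 : ℤ) else 0)
      ≤ ∑ p ∈ W, (if 1 ≤ b p.1 then (1 : ℤ) else 0) * (if 1 ≤ b' p.2 then (1 : ℤ) else 0) := by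
    calc ∑ p ∈ W, (if 1 ≤ r p.1 then (1 : ℤ) else 0) * (if 1 ≤ r' p.2 then (1 : ℤ) else 0)
        ≤ ∑ p ∈ W, (if 1 ≤ r p.1 then (1 : ℤ) else 0) * (if 1 ≤ b' p.2 then (1 : ℤ) else 0) := by
          have e1 := sum_W_eq_fst W (fun x => if 1 ≤ r x then (1 : ℤ) else 0) (fun y => if 1 ≤ r' y then (1 : ℤ) else 0)
          have e2 := sum_W_eq_fst W (fun x => if 1 ≤ r x then (1 : ℤ) else 0) (fun y => if 1 ≤ b' y then (1 : ℤ) else 0)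
          rw [e1, e2]
          apply Finset.sum_le_sum; intro x _
          apply mul_le_mul_of_nonneg_left (fibre_snd_harris' r' b' hY W hW x)
          split_ifs <;> simp
      _ ≤ ∑ p ∈ W, (if 1 ≤ b p.1 then (1 : ℤ) else 0) * (if 1 ≤ b' p.2 then (1 : ℤ) else 0) := by
          have e1 := sum_W_eq_snd W (fun x => if 1 ≤ r x then (1 : ℤ) else 0) (fun y => if 1 ≤ b' y then (1 : ℤ) else 0)
          have e2 := sum_W_eq_snd W (fun x => if 1 ≤ b x then (1 : ℤ) else 0) (fun y => if 1 ≤ b' y then (1 : ℤ) else 0)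
          rw [e1, e2]
          apply Finset.sum_le_sum; intro y _
          apply mul_le_mul_of_nonneg_left (fibre_fst_harris' r b hX W hW y)
          split_ifs <;> simp
  have e1 : ∀ p : X × Y, (if serB b b' p = 0 then (1 : ℤ) else 0)
      = 1 - (if 1 ≤ b p.1 then (1 : ℤ) else 0) * (if 1 ≤ b' p.2 then (1 : ℤ) else 0) := by
    intro p; unfold serB; split_ifs <;> omega
  have e2 : ∀ p : X × Y, (if serR r r' p = 0 then (1 : ℤ) else 0)
      = 1 - (if 1 ≤ r p.1 then (1 : ℤ) else 0) * (if 1 ≤ r' p.2 then (1 : ℤ) else 0) := by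
    intro p; unfold serR; split_ifs <;> omega
  simp only [e1, e2, Finset.sum_sub_distrib]
  linarith

/-- **(HC) is closed under parallel composition**: through `{b = 0}×{b′ = 0}` and `{r = 0}×{r′ = 0}`. -/
theorem harris_par [Preorder X] [Preorder Y] [Fintype X] [Fintype Y] [DecidableEq X] [DecidableEq Y] (r b : X → ℕ) (r' b' : Y → ℕ) (hX : HarrisCond r b) (hY : HarrisCond r' b') :
    HarrisCond (parR r r') (parB b b') := by
  intro W hW
  have e1 : ∀ p : X × Y, (if parB b b' p = 0 then (1 : ℤ) else 0) = indB0 b p.1 * indB0 b' p.2 := by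
    intro p; unfold parB indB0; split_ifs <;> omega
  have e2 : ∀ p : X × Y, (if parR r r' p = 0 then (1 : ℤ) else 0) = indR0 r p.1 * indR0 r' p.2 := by
    intro p; unfold parR indR0; split_ifs <;> omega
  simp only [e1, e2]
  calc ∑ p ∈ W, indB0 b p.1 * indB0 b' p.2
      ≤ ∑ p ∈ W, indR0 r p.1 * indB0 b' p.2 := by
        rw [sum_W_eq_snd, sum_W_eq_snd]
        apply Finset.sum_le_sum; intro y _
        have h := fibre_fst_harris r b hX W hW y
        have : ∑ x, ind W x y * indB0 b x ≤ ∑ x, ind W x y * indR0 r x := by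
          have e : ∑ x, ind W x y * indR0 r x - ∑ x, ind W x y * indB0 b x
              = ∑ x, ind W x y * (indR0 r x - indB0 b x) := by
            rw [← Finset.sum_sub_distrib]; apply Finset.sum_congr rfl; intro x _; ring
          linarith
        apply mul_le_mul_of_nonneg_left this
        unfold indB0; split_ifs <;> simp
    _ ≤ ∑ p ∈ W, indR0 r p.1 * indR0 r' p.2 := by
        rw [sum_W_eq_fst, sum_W_eq_fst]
        apply Finset.sum_le_sum; intro x _
        have h := fibre_snd_harris r' b' hY W hW x
        have : ∑ y, ind W x y * indB0 b' y ≤ ∑ y, ind W x y * indR0 r' y := by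
          have e : ∑ y, ind W x y * indR0 r' y - ∑ y, ind W x y * indB0 b' y
              = ∑ y, ind W x y * (indR0 r' y - indB0 b' y) := by
            rw [← Finset.sum_sub_distrib]; apply Finset.sum_congr rfl; intro y _; ring
          linarith
        exact mul_le_mul_of_nonneg_left this (indR0_nonneg _ _)

end fibres

end Summit.Ventures.PercRepro2.V2Closure
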